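import Literature.MeasureTheory.Group.DiscreteSubgroupDomain
import Literature.MeasureTheory.Group.DiscreteSubgroupCompactDomainPrelim
import Mathlib.Topology.UrysohnsLemma
import Mathlib.MeasureTheory.Measure.Lebesgue.Basic
import Mathlib.MeasureTheory.Group.Measure

/-!
# Compact fundamental domains with non-empty interior and null boundary

Topic `MeasureTheory/Group`. `DiscreteSubgroupDomain` / `DiscreteSubgroupDomainLindelof` produce, for a
discrete cocompact subgroup `Γ ≤ G`, a measurable RELATIVELY compact set containing exactly one point of
every orbit. Integration arguments over `Γ \ G` (e.g. non-vanishing of a theta lift tested against a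
compactly supported function) want instead ONE set `𝓕` with `IsCompact 𝓕`, `(interior 𝓕).Nonempty` AND
`IsFundamentalDomain Γ 𝓕 μ` (Mathlib's a.e. notion). This file supplies it, for every measure finite on
compact sets and left and right invariant (every Haar measure of a unimodular, e.g. commutative, group):

* `exists_nhds_null_frontier` — in a locally compact group every neighbourhood of `1` contains an open
  relatively compact neighbourhood `W` with `μ (frontier W) = 0` (Urysohn function + at most countably
  many level sets of positive measure); `exists_good_nhds` adds `W W⁻¹ ∪ W⁻¹ W ⊆ U`;
* `disjoint_smul_translate_left/op`, `exists_finset_cover_op/left` — local sets from a fixed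
  neighbourhood and finite covers modulo `Γ` (cocompactness);
* **`exists_compact_isFundamentalDomain_left`** (`Γ` normal, e.g. `G` commutative) and
  **`exists_compact_isFundamentalDomain_op`** (right action, any `Γ`): `𝓕` closed, compact, non-empty
  interior, measurable, a fundamental domain, and `𝓕 = closure 𝓕₀` for an exact measurable fundamental
  domain `𝓕₀` with `μ (𝓕 \ 𝓕₀) = 0`; primed short forms; `isMulRightInvariant_of_comm`.

Everything is proved (Mathlib + the tree files only).

## Provenance

Reproduced for the tree under the LEAN-IN-TREE rule (2026-08-18) from the pub-hodgecm cell's package file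
`HodgeCM/PerL34/CompactDomain.lean` §§4–6 (DAG-node prover #09 lineage, seat pv09-g4, gate run 26),
verbatim up to: the namespace (`HodgeCM.PerL34.DiscreteFD` ↦ `Literature.MeasureTheory.Group.DiscreteSubgroup`),
the construction (`dom` ↦ the tree's `strictFundamentalDomain`), added docstrings.
-/

set_option autoImplicit false

noncomputable section

open _root_.MeasureTheory Set _root_.Topology Filter Function
open scoped Pointwise ENNReal

namespace Literature.MeasureTheory.Group.DiscreteSubgroup

/-! ## §4 Neighbourhoods of `1` with null boundary -/

section Group

variable {G : Type*} [Group G] [TopologicalSpace G] [IsTopologicalGroup G] [LocallyCompactSpace G]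
  [T2Space G] [MeasurableSpace G] [BorelSpace G]

/-- **Null-boundary neighbourhoods.**  Every neighbourhood `U` of `1` contains an open relatively
compact neighbourhood `W` of `1` with `μ (frontier W) = 0` (for `μ` finite on compact sets): take a
Urysohn function `f` supported in a relatively compact part of `U` with `f 1 = 1`; its level sets
`{f = r}`, `0 < r < 1`, are disjoint, so at most countably many have positive measure, and
`W = {r < f}` for any other `r` works (`frontier {r < f} ⊆ {f = r}`). [folklore] -/
theorem exists_nhds_null_frontier (μ : Measure G) [IsFiniteMeasureOnCompacts μ] {U : Set G}
    (hU : U ∈ 𝓝 (1 : G)) :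
    ∃ W : Set G, IsOpen W ∧ (1 : G) ∈ W ∧ W ⊆ U ∧ IsCompact (closure W) ∧ μ (frontier W) = 0 := by
  obtain ⟨C, hC, hCU, hCc⟩ := local_compact_nhds hU
  set V : Set G := interior C with hV
  have hVo : IsOpen V := isOpen_interior
  have h1V : (1 : G) ∈ V := mem_interior_iff_mem_nhds.2 hC
  have hVcp : IsCompact (closure V) := hCc.closure_of_subset interior_subset
  obtain ⟨f, hfs, hf1, hf01⟩ := exists_tsupport_one_of_isOpen_isClosed hVo hVcp isClosed_singleton
    (singleton_subset_iff.2 h1V)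
  have hf1' : f 1 = 1 := by simpa using hf1 (mem_singleton (1 : G))
  -- the level sets of positive measure are countable
  set S : ↥(Ioo (0 : ℝ) 1) → Set G := fun r => {x | f x = (r : ℝ)} with hS
  have hSm : ∀ r, MeasurableSet (S r) := fun r =>
    (isClosed_eq f.continuous continuous_const).measurableSet
  have hSd : Pairwise (Disjoint on S) := by
    intro r r' hrr'
    refine Set.disjoint_left.2 fun x hx hx' => hrr' (Subtype.ext ?_)
    rw [← show f x = (r : ℝ) from hx, ← show f x = (r' : ℝ) from hx']
  have hSU : (⋃ r, S r) ⊆ closure V := by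
    rintro x hx
    obtain ⟨r, hr⟩ := mem_iUnion.1 hx
    have hx0 : f x ≠ 0 := by
      rw [show f x = (r : ℝ) from hr]
      exact ne_of_gt r.2.1
    exact subset_closure (hfs (subset_tsupport _ hx0))
  have hSfin : μ (⋃ r, S r) ≠ ∞ :=
    ((measure_mono hSU).trans_lt hVcp.measure_lt_top).ne
  have hcount := Measure.countable_meas_pos_of_disjoint_of_meas_iUnion_ne_top μ hSm hSd hSfin
  -- some `r ∈ (0,1)` has a null level set
  obtain ⟨r, hr⟩ : ∃ r : ↥(Ioo (0 : ℝ) 1), μ (S r) = 0 := by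
    by_contra hall
    have huniv : (univ : Set ↥(Ioo (0 : ℝ) 1)) ⊆ {r | 0 < μ (S r)} := fun r _ =>
      pos_iff_ne_zero.2 fun h => hall ⟨r, h⟩
    have hc : (univ : Set ↥(Ioo (0 : ℝ) 1)).Countable := hcount.mono huniv
    have hc' : (Ioo (0 : ℝ) 1).Countable := by
      have := hc.image ((↑) : ↥(Ioo (0 : ℝ) 1) → ℝ)
      rwa [image_univ, Subtype.range_coe] at this
    have h0 : volume (Ioo (0 : ℝ) 1) = 0 := hc'.measure_zero volume
    rw [Real.volume_Ioo] at h0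
    norm_num at h0
  refine ⟨{x | (r : ℝ) < f x}, isOpen_lt continuous_const f.continuous, ?_, ?_, ?_, ?_⟩
  · show (r : ℝ) < f 1
    rw [hf1']
    exact r.2.2
  · intro x hx
    have hx0 : f x ≠ 0 := (r.2.1.trans hx).ne'
    exact hCU (interior_subset (hfs (subset_tsupport _ hx0)))
  · refine hVcp.of_isClosed_subset isClosed_closure (closure_mono fun x hx => ?_)
    have hx0 : f x ≠ 0 := (r.2.1.trans hx).ne'
    exact hfs (subset_tsupport _ hx0)
  · refine measure_mono_null ?_ hr
    intro x hx
    have := frontier_lt_subset_eq continuous_const f.continuous hx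
    exact (this : (r : ℝ) = f x).symm

/-- A null-boundary, relatively compact, open neighbourhood `W` of `1` with `W W⁻¹ ⊆ U` and
`W⁻¹ W ⊆ U`. [folklore] -/
theorem exists_good_nhds (μ : Measure G) [IsFiniteMeasureOnCompacts μ] {U : Set G}
    (hU : U ∈ 𝓝 (1 : G)) :
    ∃ W : Set G, IsOpen W ∧ (1 : G) ∈ W ∧ (∀ a ∈ W, ∀ b ∈ W, a * b⁻¹ ∈ U) ∧
      (∀ a ∈ W, ∀ b ∈ W, a⁻¹ * b ∈ U) ∧ IsCompact (closure W) ∧ μ (frontier W) = 0 := by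
  obtain ⟨W₀, hW₀o, hW₀1, hr, hl⟩ := exists_open_symm_nhds hU
  obtain ⟨W, hWo, hW1, hWW₀, hWc, hWf⟩ := exists_nhds_null_frontier μ (hW₀o.mem_nhds hW₀1)
  exact ⟨W, hWo, hW1, fun a ha b hb => hr a (hWW₀ ha) b (hWW₀ hb),
    fun a ha b hb => hl a (hWW₀ ha) b (hWW₀ hb), hWc, hWf⟩

/-! ## §5 Local sets from a fixed neighbourhood, finite covers -/

omit [TopologicalSpace G] [IsTopologicalGroup G] [LocallyCompactSpace G] [T2Space G]
  [MeasurableSpace G] [BorelSpace G] in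
/-- Separation of the right translates `W x` under the LEFT action of `Γ`. [folklore] -/
theorem disjoint_smul_translate_left {Γ : Subgroup G} {U W : Set G}
    (hU1 : ∀ γ : Γ, (γ : G) ∈ U → γ = 1) (hWr : ∀ a ∈ W, ∀ b ∈ W, a * b⁻¹ ∈ U) (x : G)
    (γ : Γ) (hγ : γ ≠ 1) : Disjoint (γ • ((fun w => w * x) '' W)) ((fun w => w * x) '' W) := by
  refine Set.disjoint_left.2 ?_
  rintro z hz ⟨b, hb, rfl⟩
  obtain ⟨y, ⟨a, ha, rfl⟩, hy⟩ := mem_smul_set.1 hz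
  apply hγ
  apply hU1
  rw [Subgroup.smul_def, smul_eq_mul] at hy
  have : (γ : G) = b * a⁻¹ := by
    calc (γ : G) = (γ : G) * (a * x) * (a * x)⁻¹ := by group
    _ = b * a⁻¹ := by rw [hy]; group
  rw [this]
  exact hWr b hb a ha

omit [TopologicalSpace G] [IsTopologicalGroup G] [LocallyCompactSpace G] [T2Space G]
  [MeasurableSpace G] [BorelSpace G] in
/-- Separation of the left translates `x W` under the RIGHT action (`Γ.op`). [folklore] -/
theorem disjoint_smul_translate_op {Γ : Subgroup G} {U W : Set G}
    (hU1 : ∀ γ : Γ, (γ : G) ∈ U → γ = 1) (hWl : ∀ a ∈ W, ∀ b ∈ W, a⁻¹ * b ∈ U) (x : G)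
    (γ : Γ.op) (hγ : γ ≠ 1) : Disjoint (γ • ((fun w => x * w) '' W)) ((fun w => x * w) '' W) := by
  refine Set.disjoint_left.2 ?_
  rintro z hz ⟨b, hb, rfl⟩
  obtain ⟨y, ⟨a, ha, rfl⟩, hy⟩ := mem_smul_set.1 hz
  have hmem : MulOpposite.unop (γ : Gᵐᵒᵖ) ∈ Γ := Subgroup.mem_op.1 γ.2
  apply hγ
  rw [Subgroup.smul_def, MulOpposite.smul_eq_mul_unop] at hy
  have hval : MulOpposite.unop (γ : Gᵐᵒᵖ) = a⁻¹ * b := by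
    calc MulOpposite.unop (γ : Gᵐᵒᵖ)
        = (x * a)⁻¹ * ((x * a) * MulOpposite.unop (γ : Gᵐᵒᵖ)) := by group
    _ = a⁻¹ * b := by rw [hy]; group
  have h1 : (⟨MulOpposite.unop (γ : Gᵐᵒᵖ), hmem⟩ : Γ) = 1 := by
    apply hU1
    show MulOpposite.unop (γ : Gᵐᵒᵖ) ∈ U
    rw [hval]
    exact hWl a ha b hb
  have h2 : MulOpposite.unop (γ : Gᵐᵒᵖ) = 1 := congrArg Subtype.val h1
  exact Subtype.ext ((MulOpposite.unop_eq_one_iff _).1 h2)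

omit [T2Space G] [MeasurableSpace G] [BorelSpace G] in
/-- Cocompactness: finitely many left translates `x W` meet every right `Γ`-orbit. [folklore] -/
theorem exists_finset_cover_op (Γ : Subgroup G) [CompactSpace (G ⧸ Γ)] {W : Set G}
    (hWo : IsOpen W) (hW1 : (1 : G) ∈ W) :
    ∃ t : Finset G, ∀ y : G, ∃ γ : Γ.op, ∃ x ∈ t, γ • y ∈ (fun w => x * w) '' W := by
  obtain ⟨K, hKc, -, hK⟩ := exists_isCompact_cover_op Γ
  obtain ⟨t, ht⟩ := hKc.elim_finite_subcover (fun x : G => (fun w => x * w) '' W)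
    (fun x => isOpenMap_mul_left x W hWo) fun x hx => mem_iUnion.2 ⟨x, 1, hW1, mul_one x⟩
  refine ⟨t, fun y => ?_⟩
  obtain ⟨γ, hγ⟩ := hK y
  obtain ⟨x, hx, hx'⟩ := mem_iUnion₂.1 (ht hγ)
  exact ⟨γ, x, hx, hx'⟩

omit [T2Space G] [MeasurableSpace G] [BorelSpace G] in
/-- Cocompactness, `Γ` normal: finitely many right translates `W x` meet every left `Γ`-orbit. [folklore] -/
theorem exists_finset_cover_left (Γ : Subgroup G) [Γ.Normal] [CompactSpace (G ⧸ Γ)] {W : Set G}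
    (hWo : IsOpen W) (hW1 : (1 : G) ∈ W) :
    ∃ t : Finset G, ∀ y : G, ∃ γ : Γ, ∃ x ∈ t, γ • y ∈ (fun w => w * x) '' W := by
  obtain ⟨K, hKc, -, hK⟩ := exists_isCompact_cover_left Γ
  obtain ⟨t, ht⟩ := hKc.elim_finite_subcover (fun x : G => (fun w => w * x) '' W)
    (fun x => isOpenMap_mul_right x W hWo) fun x hx => mem_iUnion.2 ⟨x, 1, hW1, one_mul x⟩
  refine ⟨t, fun y => ?_⟩
  obtain ⟨γ, hγ⟩ := hK y
  obtain ⟨x, hx, hx'⟩ := mem_iUnion₂.1 (ht hγ)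
  exact ⟨γ, x, hx, hx'⟩

/-! ## §6 Compact fundamental domains with non-empty interior -/

/-- **Compact fundamental domain, LEFT action, `Γ` normal (e.g. `G` commutative).**  For a discrete,
countable, cocompact normal subgroup `Γ` and a measure `μ` finite on compact sets and left and right
invariant, there is a COMPACT set `𝓕` with NON-EMPTY INTERIOR which is a fundamental domain of the left
action of `Γ` (`IsFundamentalDomain Γ 𝓕 μ`); moreover `𝓕` is the closure of an exact measurable
fundamental domain `𝓕₀` and `μ (𝓕 \ 𝓕₀) = 0`. [folklore] -/
theorem exists_compact_isFundamentalDomain_left (Γ : Subgroup G) [DiscreteTopology Γ] [Countable Γ]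
    [Γ.Normal] [CompactSpace (G ⧸ Γ)] (μ : Measure G) [IsFiniteMeasureOnCompacts μ]
    [μ.IsMulLeftInvariant] [μ.IsMulRightInvariant] :
    ∃ 𝓕 𝓕₀ : Set G, IsCompact 𝓕 ∧ IsClosed 𝓕 ∧ (interior 𝓕).Nonempty ∧ MeasurableSet 𝓕 ∧
      IsFundamentalDomain Γ 𝓕 μ ∧ MeasurableSet 𝓕₀ ∧ 𝓕₀ ⊆ 𝓕 ∧ 𝓕 = closure 𝓕₀ ∧
      μ (𝓕 \ 𝓕₀) = 0 ∧ ∀ x : G, ∃! γ : Γ, γ • x ∈ 𝓕₀ := by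
  classical
  obtain ⟨U, hU, hU1⟩ := exists_nhds_one_eq_one Γ
  obtain ⟨W, hWo, hW1, hWr, -, hWc, hWf⟩ := exists_good_nhds μ hU
  obtain ⟨t, ht⟩ := exists_finset_cover_left Γ hWo hW1
  set V : G → Set G := fun x => (fun w => w * x) '' W with hV
  set A : ℕ → Set G := localFamily t V with hA
  have hAo : ∀ n, IsOpen (A n) :=
    localFamily_induction t V isOpen_empty fun x _ => isOpenMap_mul_right x W hWo
  have hdisj : ∀ (n : ℕ) (γ : Γ), γ ≠ 1 → Disjoint (γ • A n) (A n) := fun n γ hγ =>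
    localFamily_induction t V (p := fun s => Disjoint (γ • s) s) (by simp)
      (fun x _ => disjoint_smul_translate_left hU1 hWr x γ hγ) n
  have hcov : ∀ y : G, ∃ (γ : Γ) (n : ℕ), γ • y ∈ A n := by
    intro y
    obtain ⟨γ, x, hx, hγ⟩ := ht y
    obtain ⟨n, hn⟩ := exists_localFamily_eq t V hx
    refine ⟨γ, n, ?_⟩
    show γ • y ∈ localFamily t V n
    rw [hn]
    exact hγ
  have hex : ∀ y : G, ∃! γ : Γ, γ • y ∈ strictFundamentalDomain Γ A :=
    existsUnique_smul_mem_strictFundamentalDomain' hdisj hcov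
  have h𝓕₀m : MeasurableSet (strictFundamentalDomain Γ A) :=
    measurableSet_strictFundamentalDomain' fun n => (hAo n).measurableSet
  -- the first local set is a non-empty open subset
  obtain ⟨γ₁, x₁, hx₁, -⟩ := ht 1
  have hcard : 0 < t.card := Finset.card_pos.2 ⟨x₁, hx₁⟩
  have hA0 : A 0 = V ((t.equivFin.symm ⟨0, hcard⟩ : ↥t) : G) := localFamily_of_lt t V hcard
  -- compactness of the closure
  have hsub : strictFundamentalDomain Γ A ⊆ ⋃ x ∈ t, (fun w => w * x) '' closure W :=
    (strictFundamentalDomain_subset (K := ⋃ x ∈ t, V x) (localFamily_subset t V)).trans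
      (iUnion₂_mono fun x _ => image_mono subset_closure)
  have hcpt : IsCompact (closure (strictFundamentalDomain Γ A)) :=
    (t.isCompact_biUnion fun x _ => hWc.image (continuous_id.mul continuous_const)).closure_of_subset
      hsub
  -- the boundary is null
  have hnull : μ (closure (strictFundamentalDomain Γ A) \ strictFundamentalDomain Γ A) = 0 := by
    refine measure_mono_null (closure_strictFundamentalDomain_diff_subset hAo fun n hn => localFamily_of_le t V hn)
      (measure_iUnion_null_iff.2 fun n => ?_)
    refine localFamily_induction t V (p := fun s => μ (frontier s) = 0) (by simp) (fun x _ => ?_) n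
    show μ (frontier ((fun w => w * x) '' W)) = 0
    rw [show (fun w => w * x) = ⇑(Homeomorph.mulRight x) from rfl, ← Homeomorph.image_frontier,
      Homeomorph.coe_mulRight, image_mul_right, measure_preimage_mul_right]
    exact hWf
  refine ⟨closure (strictFundamentalDomain Γ A), strictFundamentalDomain Γ A, hcpt, isClosed_closure, ?_,
    isClosed_closure.measurableSet, ?_, h𝓕₀m, subset_closure, rfl, hnull, hex⟩
  · refine ⟨(t.equivFin.symm ⟨0, hcard⟩ : ↥t), subset_interior_closure_strictFundamentalDomain (hAo 0) ?_⟩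
    rw [hA0]
    exact ⟨1, hW1, one_mul _⟩
  · exact isFundamentalDomain_of_exact_of_null μ hex subset_closure
      isClosed_closure.measurableSet.nullMeasurableSet hnull

/-- **Compact fundamental domain, RIGHT action (`Γ.op`), any discrete countable cocompact `Γ`.** [folklore] -/
theorem exists_compact_isFundamentalDomain_op (Γ : Subgroup G) [DiscreteTopology Γ] [Countable Γ]
    [CompactSpace (G ⧸ Γ)] (μ : Measure G) [IsFiniteMeasureOnCompacts μ]
    [μ.IsMulLeftInvariant] [μ.IsMulRightInvariant] :
    ∃ 𝓕 𝓕₀ : Set G, IsCompact 𝓕 ∧ IsClosed 𝓕 ∧ (interior 𝓕).Nonempty ∧ MeasurableSet 𝓕 ∧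
      IsFundamentalDomain Γ.op 𝓕 μ ∧ MeasurableSet 𝓕₀ ∧ 𝓕₀ ⊆ 𝓕 ∧ 𝓕 = closure 𝓕₀ ∧
      μ (𝓕 \ 𝓕₀) = 0 ∧ ∀ x : G, ∃! γ : Γ.op, γ • x ∈ 𝓕₀ := by
  classical
  obtain ⟨U, hU, hU1⟩ := exists_nhds_one_eq_one Γ
  obtain ⟨W, hWo, hW1, -, hWl, hWc, hWf⟩ := exists_good_nhds μ hU
  obtain ⟨t, ht⟩ := exists_finset_cover_op Γ hWo hW1
  set V : G → Set G := fun x => (fun w => x * w) '' W with hV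
  set A : ℕ → Set G := localFamily t V with hA
  have hAo : ∀ n, IsOpen (A n) :=
    localFamily_induction t V isOpen_empty fun x _ => isOpenMap_mul_left x W hWo
  have hdisj : ∀ (n : ℕ) (γ : Γ.op), γ ≠ 1 → Disjoint (γ • A n) (A n) := fun n γ hγ =>
    localFamily_induction t V (p := fun s => Disjoint (γ • s) s) (by simp)
      (fun x _ => disjoint_smul_translate_op hU1 hWl x γ hγ) n
  have hcov : ∀ y : G, ∃ (γ : Γ.op) (n : ℕ), γ • y ∈ A n := by
    intro y
    obtain ⟨γ, x, hx, hγ⟩ := ht y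
    obtain ⟨n, hn⟩ := exists_localFamily_eq t V hx
    refine ⟨γ, n, ?_⟩
    show γ • y ∈ localFamily t V n
    rw [hn]
    exact hγ
  have hex : ∀ y : G, ∃! γ : Γ.op, γ • y ∈ strictFundamentalDomain Γ.op A :=
    existsUnique_smul_mem_strictFundamentalDomain' hdisj hcov
  have h𝓕₀m : MeasurableSet (strictFundamentalDomain Γ.op A) :=
    measurableSet_strictFundamentalDomain' fun n => (hAo n).measurableSet
  obtain ⟨γ₁, x₁, hx₁, -⟩ := ht 1
  have hcard : 0 < t.card := Finset.card_pos.2 ⟨x₁, hx₁⟩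
  have hA0 : A 0 = V ((t.equivFin.symm ⟨0, hcard⟩ : ↥t) : G) := localFamily_of_lt t V hcard
  have hsub : strictFundamentalDomain Γ.op A ⊆ ⋃ x ∈ t, (fun w => x * w) '' closure W :=
    (strictFundamentalDomain_subset (K := ⋃ x ∈ t, V x) (localFamily_subset t V)).trans
      (iUnion₂_mono fun x _ => image_mono subset_closure)
  have hcpt : IsCompact (closure (strictFundamentalDomain Γ.op A)) :=
    (t.isCompact_biUnion fun x _ => hWc.image (continuous_const.mul continuous_id)).closure_of_subset
      hsub
  have hnull : μ (closure (strictFundamentalDomain Γ.op A) \ strictFundamentalDomain Γ.op A) = 0 := by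
    refine measure_mono_null (closure_strictFundamentalDomain_diff_subset hAo fun n hn => localFamily_of_le t V hn)
      (measure_iUnion_null_iff.2 fun n => ?_)
    refine localFamily_induction t V (p := fun s => μ (frontier s) = 0) (by simp) (fun x _ => ?_) n
    show μ (frontier ((fun w => x * w) '' W)) = 0
    rw [show (fun w => x * w) = ⇑(Homeomorph.mulLeft x) from rfl, ← Homeomorph.image_frontier,
      Homeomorph.coe_mulLeft, image_mul_left, measure_preimage_mul]
    exact hWf
  refine ⟨closure (strictFundamentalDomain Γ.op A), strictFundamentalDomain Γ.op A, hcpt, isClosed_closure, ?_,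
    isClosed_closure.measurableSet, ?_, h𝓕₀m, subset_closure, rfl, hnull, hex⟩
  · refine ⟨(t.equivFin.symm ⟨0, hcard⟩ : ↥t), subset_interior_closure_strictFundamentalDomain (hAo 0) ?_⟩
    rw [hA0]
    exact ⟨1, hW1, mul_one _⟩
  · exact isFundamentalDomain_of_exact_of_null μ hex subset_closure
      isClosed_closure.measurableSet.nullMeasurableSet hnull

/-- Short form, left action. [folklore] -/
theorem exists_compact_isFundamentalDomain_left' (Γ : Subgroup G) [DiscreteTopology Γ]
    [Countable Γ] [Γ.Normal] [CompactSpace (G ⧸ Γ)] (μ : Measure G) [IsFiniteMeasureOnCompacts μ]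
    [μ.IsMulLeftInvariant] [μ.IsMulRightInvariant] :
    ∃ 𝓕 : Set G, IsCompact 𝓕 ∧ (interior 𝓕).Nonempty ∧ MeasurableSet 𝓕 ∧
      IsFundamentalDomain Γ 𝓕 μ := by
  obtain ⟨𝓕, -, h1, -, h2, h3, h4, -⟩ := exists_compact_isFundamentalDomain_left Γ μ
  exact ⟨𝓕, h1, h2, h3, h4⟩

/-- Short form, right action. [folklore] -/
theorem exists_compact_isFundamentalDomain_op' (Γ : Subgroup G) [DiscreteTopology Γ]
    [Countable Γ] [CompactSpace (G ⧸ Γ)] (μ : Measure G) [IsFiniteMeasureOnCompacts μ]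
    [μ.IsMulLeftInvariant] [μ.IsMulRightInvariant] :
    ∃ 𝓕 : Set G, IsCompact 𝓕 ∧ (interior 𝓕).Nonempty ∧ MeasurableSet 𝓕 ∧
      IsFundamentalDomain Γ.op 𝓕 μ := by
  obtain ⟨𝓕, -, h1, -, h2, h3, h4, -⟩ := exists_compact_isFundamentalDomain_op Γ μ
  exact ⟨𝓕, h1, h2, h3, h4⟩

omit [LocallyCompactSpace G] [T2Space G] [IsTopologicalGroup G] [BorelSpace G] in
/-- On a commutative group a left invariant measure is right invariant. [folklore] -/
theorem isMulRightInvariant_of_comm {G : Type*} [CommGroup G] [MeasurableSpace G] (μ : Measure G)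
    [μ.IsMulLeftInvariant] : μ.IsMulRightInvariant := by
  constructor
  intro g
  have : (fun x : G => x * g) = fun x => g * x := funext fun x => mul_comm x g
  rw [this]
  exact map_mul_left_eq_self μ g

end Group

end Literature.MeasureTheory.Group.DiscreteSubgroup
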